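import Literature.NumberTheory.Automorphic.UnboundedDenominatorsOfCor453
import Mathlib.GroupTheory.SpecificGroups.Cyclic
import Mathlib.GroupTheory.Perm.Cycle.Type
import HarnessLib

/-!
# The unbounded denominators theorem (Calegari–Dimitrov–Tang) — dévissage of Corollary 4.5.3 from `𝐅_ℓ` to finite abelian coefficients

PROOF-ONLY sequel of `UnboundedDenominatorsOfCor453.lean` (no definition, no named fact; D-0026).  CDT state
Corollary 4.5.3 for classes `η ∈ H¹(Γ(N), 𝐅_ℓ)` (J. AMS 38 (2025), §4.5: "Let `N` be an integer, and
`η ∈ H¹(Γ(N), 𝐅_ℓ)`. If, for all `g ∈ SL₂(ℤ/Nℤ)`, the class `gη − η` is a congruence class, then `η` is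
congruence"), and remark that the `𝐐/𝐙`-version follows.  The tree's assembly consumes the FINITE-ABELIAN
version (`of_cor453`, `of_cor453_invariant`).  Here we kernel-check the dévissage, so that the named fact the
planner files can be CDT's sentence VERBATIM (homomorphisms `Γ(N) → ℤ/ℓ`, all primes `ℓ`, all levels `N`):

* `cor453_invariant_of_modPrime` — if every `SL₂(ℤ)`-conjugation-invariant `η : Γ(N) → ℤ/ℓ` (`ℓ` prime) is
  trivial on some `Γ(M)`, then so is every invariant `θ : Γ(N) → Q`, `Q` finite abelian (induction on `|Q|`
  through a subgroup `⟨q⟩ ≅ ℤ/ℓ` of prime order: `θ mod ⟨q⟩` is congruence by induction, and on the resulting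
  `Γ(N M₁)` the values of `θ` form an invariant `ℤ/ℓ`-valued class);
* `CalegariDimitrovTang2025_unboundedDenominators.of_cor453_modPrime_invariant` — CDT Thm 1.0.1 from the
  invariant `𝐅_ℓ`-form;
* `CalegariDimitrovTang2025_unboundedDenominators.of_cor453_modPrime` — CDT Thm 1.0.1 from Corollary 4.5.3 AS
  PRINTED (`𝐅_ℓ`-coefficients, hypothesis "every `x ↦ η(g x g⁻¹) η(x)⁻¹` is congruence").

## References

* [CalegariDimitrovTang2025] F. Calegari, V. Dimitrov, Y. Tang, The unbounded denominators conjecture,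
  J. Amer. Math. Soc. 38 (2025), Thm. 1.0.1, Thm. 4.5.2, Cor. 4.5.3.
-/

set_option autoImplicit false

noncomputable section

open scoped MatrixGroups
open CongruenceSubgroup Matrix.SpecialLinearGroup

namespace Literature.NumberTheory.Automorphic

namespace UnboundedDenominators

/-- `Γ(a·b) ≤ Γ(a)`. [folklore] -/
private lemma mem_Gamma_of_mem_Gamma_mul {a b : ℕ} {x : SL(2, ℤ)} (hx : x ∈ Gamma (a * b)) : x ∈ Gamma a := by
  rw [Gamma_mem] at hx ⊢
  obtain ⟨h00, h01, h10, h11⟩ := hx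
  have cast : ∀ z : ℤ, ((z : ZMod (a * b)) = 0) → ((z : ZMod a) = 0) := fun z hz ↦ by
    rw [ZMod.intCast_zmod_eq_zero_iff_dvd] at hz ⊢
    exact dvd_trans (by exact_mod_cast dvd_mul_right a b) hz
  have cast1 : ∀ z : ℤ, ((z : ZMod (a * b)) = 1) → ((z : ZMod a) = 1) := fun z hz ↦ by
    have : ((z - 1 : ℤ) : ZMod (a * b)) = 0 := by rw [Int.cast_sub, Int.cast_one, hz, sub_self]
    have := cast _ this
    rwa [Int.cast_sub, Int.cast_one, sub_eq_zero] at this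
  exact ⟨cast1 _ h00, cast _ h01, cast _ h10, cast1 _ h11⟩

/-- **Dévissage: Corollary 4.5.3 for `𝐅_ℓ`-coefficients (all primes `ℓ`, all levels) implies it for finite
abelian coefficients** (invariant forms).  Induction on `|Q|`: an invariant `θ : Γ(N) → Q` becomes congruence
modulo a subgroup `⟨q⟩ ≅ ℤ/ℓ` of prime order by induction, and the restriction of `θ` to the resulting
congruence subgroup is an invariant `𝐅_ℓ`-valued class. [cite: CalegariDimitrovTang2025, Corollary 4.5.3
("It follows that the invariant subspace of `H̃¹(𝐐/𝐙)` is also trivial")] -/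
theorem cor453_invariant_of_modPrime
    (hFl : ∀ (ℓ : ℕ) [Fact ℓ.Prime] (N : ℕ) (η : Gamma N →* Multiplicative (ZMod ℓ)),
      (∀ (g x : SL(2, ℤ)) (hx : x ∈ Gamma N) (hgx : g * x * g⁻¹ ∈ Gamma N),
        η ⟨g * x * g⁻¹, hgx⟩ = η ⟨x, hx⟩) →
      ∃ M : ℕ, M ≠ 0 ∧ ∀ (x : SL(2, ℤ)) (hx : x ∈ Gamma N), x ∈ Gamma M → η ⟨x, hx⟩ = 1) :
    ∀ (N : ℕ) (Q : Type) [CommGroup Q] [Finite Q] (θ : Gamma N →* Q),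
      (∀ (g x : SL(2, ℤ)) (hx : x ∈ Gamma N) (hgx : g * x * g⁻¹ ∈ Gamma N),
        θ ⟨g * x * g⁻¹, hgx⟩ = θ ⟨x, hx⟩) →
      ∃ M : ℕ, M ≠ 0 ∧ ∀ (x : SL(2, ℤ)) (hx : x ∈ Gamma N), x ∈ Gamma M → θ ⟨x, hx⟩ = 1 := by
  -- strong induction on the order of `Q`
  suffices h : ∀ (n : ℕ) (N : ℕ) (Q : Type) [CommGroup Q] [Finite Q] (θ : Gamma N →* Q), Nat.card Q = n →
      (∀ (g x : SL(2, ℤ)) (hx : x ∈ Gamma N) (hgx : g * x * g⁻¹ ∈ Gamma N),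
        θ ⟨g * x * g⁻¹, hgx⟩ = θ ⟨x, hx⟩) →
      ∃ M : ℕ, M ≠ 0 ∧ ∀ (x : SL(2, ℤ)) (hx : x ∈ Gamma N), x ∈ Gamma M → θ ⟨x, hx⟩ = 1 from
    fun N Q _ _ θ hθ ↦ h _ N Q θ rfl hθ
  intro n
  induction n using Nat.strong_induction_on with
  | _ n ih =>
  intro N Q _ _ θ hn hθ
  -- the degenerate level `N = 0` (`Γ(0) = ⊥`)
  rcases Nat.eq_zero_or_pos N with rfl | hNpos
  · refine ⟨1, one_ne_zero, fun x hx _ ↦ ?_⟩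
    have hx1 : x = 1 := by simpa [Gamma_zero_bot] using hx
    subst hx1
    have : (⟨1, hx⟩ : Gamma 0) = 1 := rfl
    rw [this, map_one]
  by_cases h1 : Nat.card Q = 1
  · -- trivial group
    haveI : Subsingleton Q := (Nat.card_eq_one_iff_unique.mp h1).1
    exact ⟨1, one_ne_zero, fun x hx _ ↦ Subsingleton.elim _ _⟩
  -- a subgroup of prime order `ℓ`
  obtain ⟨ℓ, hℓ, hℓdvd⟩ := Nat.exists_prime_and_dvd h1
  haveI : Fact ℓ.Prime := ⟨hℓ⟩
  obtain ⟨q, hq⟩ := exists_prime_orderOf_dvd_card' (G := Q) ℓ hℓdvd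
  let H : Subgroup Q := Subgroup.zpowers q
  have hHcard : Nat.card H = ℓ := by rw [Nat.card_zpowers, hq]
  -- the quotient `Q ⧸ H` is smaller: induction gives `M₁`
  have hcardQ : Nat.card Q = Nat.card (Q ⧸ H) * ℓ := by
    rw [← hHcard]; exact Subgroup.card_eq_card_quotient_mul_card_subgroup H
  have hlt : Nat.card (Q ⧸ H) < n := by
    rw [← hn, hcardQ]
    have hpos : 0 < Nat.card (Q ⧸ H) := Nat.card_pos
    nlinarith [hℓ.one_lt]
  let θ' : Gamma N →* Q ⧸ H := (QuotientGroup.mk' H).comp θ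
  have hθ' : ∀ (g x : SL(2, ℤ)) (hx : x ∈ Gamma N) (hgx : g * x * g⁻¹ ∈ Gamma N),
      θ' ⟨g * x * g⁻¹, hgx⟩ = θ' ⟨x, hx⟩ := fun g x hx hgx ↦ by
    simp only [θ', MonoidHom.coe_comp, Function.comp_apply, hθ g x hx hgx]
  obtain ⟨M₁, hM₁, hker₁⟩ := ih _ hlt N (Q ⧸ H) θ' rfl hθ'
  -- on `Γ(N M₁)` the values of `θ` lie in `H ≅ ℤ/ℓ`
  have hmemH : ∀ (x : SL(2, ℤ)) (hx : x ∈ Gamma (N * M₁)), θ ⟨x, mem_Gamma_of_mem_Gamma_mul hx⟩ ∈ H := by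
    intro x hx
    have hxM : x ∈ Gamma M₁ := mem_Gamma_of_mem_Gamma_mul (by rwa [mul_comm] at hx)
    have := hker₁ x (mem_Gamma_of_mem_Gamma_mul hx) hxM
    simpa [θ', QuotientGroup.mk'_apply, QuotientGroup.eq_one_iff] using this
  let θ₁ : Gamma (N * M₁) →* H :=
    (θ.comp (Subgroup.inclusion fun x hx ↦ mem_Gamma_of_mem_Gamma_mul hx)).codRestrict H
      (fun x ↦ hmemH x.1 x.2)
  -- `H ≃ Multiplicative (ZMod ℓ)`
  haveI : IsCyclic H := Subgroup.isCyclic_zpowers q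
  haveI : NeZero ℓ := ⟨hℓ.ne_zero⟩
  have hcard' : Nat.card H = Nat.card (Multiplicative (ZMod ℓ)) := by rw [hHcard]; simp
  let e : H ≃* Multiplicative (ZMod ℓ) := mulEquivOfCyclicCardEq hcard'
  let η : Gamma (N * M₁) →* Multiplicative (ZMod ℓ) := e.toMonoidHom.comp θ₁
  have hη : ∀ (g x : SL(2, ℤ)) (hx : x ∈ Gamma (N * M₁)) (hgx : g * x * g⁻¹ ∈ Gamma (N * M₁)),
      η ⟨g * x * g⁻¹, hgx⟩ = η ⟨x, hx⟩ := by
    intro g x hx hgx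
    simp only [η, MonoidHom.coe_comp, Function.comp_apply, MulEquiv.coe_toMonoidHom]
    congr 1
    apply Subtype.ext
    simp only [θ₁, MonoidHom.codRestrict_apply, MonoidHom.coe_comp, Function.comp_apply]
    exact hθ g x (mem_Gamma_of_mem_Gamma_mul hx) (mem_Gamma_of_mem_Gamma_mul hgx)
  obtain ⟨M₂, hM₂, hker₂⟩ := hFl ℓ (N * M₁) η hη
  -- conclusion with `M = N M₁ M₂`
  refine ⟨N * M₁ * M₂, Nat.mul_ne_zero (Nat.mul_ne_zero hNpos.ne' hM₁) hM₂, fun x hx hxM ↦ ?_⟩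
  · have hx1 : x ∈ Gamma (N * M₁) := mem_Gamma_of_mem_Gamma_mul hxM
    have hx2 : x ∈ Gamma M₂ := mem_Gamma_of_mem_Gamma_mul (a := M₂) (b := N * M₁) (by rwa [mul_comm] at hxM)
    have h := hker₂ x hx1 hx2
    -- `η x = 1` ⇒ `θ₁ x = 1` ⇒ `θ x = 1`
    have h' : θ₁ ⟨x, hx1⟩ = 1 := by
      have : e (θ₁ ⟨x, hx1⟩) = e 1 := by rw [map_one]; exact h
      exact e.injective this
    have h'' := congrArg Subtype.val h'
    have hincl : (Subgroup.inclusion (fun x hx ↦ mem_Gamma_of_mem_Gamma_mul hx) ⟨x, hx1⟩ : Gamma N) = ⟨x, hx⟩ :=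
      Subtype.ext rfl
    simpa [θ₁, hincl] using h''

end UnboundedDenominators

open UnboundedDenominators

/-- **CDT Theorem 1.0.1 from Corollary 4.5.3 with `𝐅_ℓ`-coefficients, invariant form**: if for every prime `ℓ`
and level `N` every `SL₂(ℤ)`-conjugation-invariant homomorphism `Γ(N) → ℤ/ℓ` is trivial on some `Γ(M)`,
`M ≠ 0`, then the unbounded denominators theorem holds. [cite: CalegariDimitrovTang2025, Thm. 1.0.1 and Cor. 4.5.3] -/
theorem _root_.Literature.NumberTheory.Automorphic.CalegariDimitrovTang2025_unboundedDenominators.of_cor453_modPrime_invariant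
    (hFl : ∀ (ℓ : ℕ) [Fact ℓ.Prime] (N : ℕ) (η : Gamma N →* Multiplicative (ZMod ℓ)),
      (∀ (g x : SL(2, ℤ)) (hx : x ∈ Gamma N) (hgx : g * x * g⁻¹ ∈ Gamma N),
        η ⟨g * x * g⁻¹, hgx⟩ = η ⟨x, hx⟩) →
      ∃ M : ℕ, M ≠ 0 ∧ ∀ (x : SL(2, ℤ)) (hx : x ∈ Gamma N), x ∈ Gamma M → η ⟨x, hx⟩ = 1) :
    CalegariDimitrovTang2025_unboundedDenominators :=
  CalegariDimitrovTang2025_unboundedDenominators.of_cor453_invariant (cor453_invariant_of_modPrime hFl)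

/-- **CDT Theorem 1.0.1 from Corollary 4.5.3 AS PRINTED** (`η ∈ H¹(Γ(N), 𝐅_ℓ)`; "if, for all
`g ∈ SL₂(ℤ/Nℤ)`, the class `gη − η` is a congruence class, then `η` is congruence" — a congruence class being one
that vanishes on some `Γ(M)`): the last printed input of the tree's formalisation of the unbounded denominators
theorem. [cite: CalegariDimitrovTang2025, Thm. 1.0.1, Thm. 4.5.2 and Cor. 4.5.3] -/
theorem _root_.Literature.NumberTheory.Automorphic.CalegariDimitrovTang2025_unboundedDenominators.of_cor453_modPrime
    (hFl : ∀ (ℓ : ℕ) [Fact ℓ.Prime] (N : ℕ) (η : Gamma N →* Multiplicative (ZMod ℓ)),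
      (∀ g : SL(2, ℤ), ∃ M : ℕ, M ≠ 0 ∧ ∀ (x : SL(2, ℤ)) (hx : x ∈ Gamma N)
        (hgx : g * x * g⁻¹ ∈ Gamma N), x ∈ Gamma M → η ⟨g * x * g⁻¹, hgx⟩ = η ⟨x, hx⟩) →
      ∃ M : ℕ, M ≠ 0 ∧ ∀ (x : SL(2, ℤ)) (hx : x ∈ Gamma N), x ∈ Gamma M → η ⟨x, hx⟩ = 1) :
    CalegariDimitrovTang2025_unboundedDenominators :=
  CalegariDimitrovTang2025_unboundedDenominators.of_cor453_modPrime_invariant fun ℓ _ N η hη ↦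
    hFl ℓ N η fun g ↦ ⟨1, one_ne_zero, fun x hx hgx _ ↦ hη g x hx hgx⟩

end Literature.NumberTheory.Automorphic

end
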